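import Summits.ResolutionOfSingularities.ResolutionOfSingularities.Theorems.ConeExit.Negative.Mirror
import Summits.ResolutionOfSingularities.ResolutionOfSingularities.Theorems.ConeExit.Negative.ChernFalseAtTwo
import Summits.ResolutionOfSingularities.ResolutionOfSingularities.Theorems.ConeExit.Negative.FalseWithoutN3
import Summits.ResolutionOfSingularities.ResolutionOfSingularities.Theorems.ConeExit.Negative.FalseWithoutPNe2
import Summits.ResolutionOfSingularities.ResolutionOfSingularities.Theorems.ConeExit.Negative.ConverseFalse
import Summits.ResolutionOfSingularities.ResolutionOfSingularities.Theorems.ConeExit.Negative.StepHypotheses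

/-!
# Disproof of `ConeExit` (crux stmt-ResolutionOfSingularities-16883, route `WildCones`) — findings

**VERDICT (cdisprove cycles 1–2, 2026-08-17): NO KILL — the crux is TRUE as typed.** It resists every
attack because it REDUCES to the Chern / Euler–Koszul critical-direction lemma (support item
`ChernCriticalDirection`, stmt-16885) plus chart algebra and one dimension count; two seats (c1, c2)
re-derived the proof independently and agree with the route-review / attack / strategist sketches.
EVERYTHING CONCLUSIVE IS LANDED under `Theorems/ConeExit/Negative/` (8 files, all ACCEPTED) and this
work file is now a thin, kernel-checked INDEX over those tree files (it imports them; the `Without…`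
propositions are named here and refuted by the tree theorems, whose inline bodies they match
definitionally). What is recorded (prose only in docstrings; `sorry`-free):

* §1–§2 (LANDED, imported): the crux's `let`-calculus mirrored verbatim as tree `def`s
  (`Theorems/ConeExit/Negative/Mirror.lean`, p154980 ACCEPTED) with `crux_iff : ConeExit ↔ … := Iff.rfl`
  (the mirror is EXACT) and the kernel-checkable CERTIFICATE FORMAT for `Isol`
  (`module_finite_quotient_of_X_pow_mem`: `X_k ^ N ∈ J ∀ k ⇒ κ[[X]] ⧸ J` module-finite). ENCODING
  AUDIT (c1): the literal calculus (`bl` guard, `dv` shift, the `piFinset (range (B i + s + 1))`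
  truncation in `tr`, `clean`) agrees with an independent polynomial-substitution strict transform on
  600 random `(p, n, i, τ, c)` incl. `τ ≠ 0` and the `s = 0` branch (item evidence
  `coneexit_cdisprove_compute.txt`); no junk operator is reachable under `MultP c`.
* §3 LOAD-BEARING HYPOTHESES — the complete table (defs `ConeExitWithout…` here; tree versions state
  the negated body INLINE, because a `def … : Prop` under `Theorems/` is audited as a vendored fact):
  - `3 ≤ n` — LOAD-BEARING. `coneExit_false_without_N3` PROVED: `p = 3`, `n = 2`, `𝔽₃`, `a = u₁⁴ + u₂⁷`
    (isolated, multiplicity 3, cleaned order 4) has the isolated multiplicity-3 successor `u₁⁴u₂ + u₂⁴`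
    in the `u₂`-chart at `τ = 0`; `OrdP` fails. Tree: `Negative/FalseWithoutN3.lean` (p161940, c2, ACCEPTED).
    Moral: Case A (`stub_caseA`) must use `n - 1 ≥ 2`.
  - `p ≠ 2` — LOAD-BEARING, at both levels. Mechanism: `chernCriticalDirection_false_without_pne2`
    (contact form `X₀X₁`, `s = 2`; Chern number `((p-1)^s-(-1)^s)/p = 0` iff `(p,s) = (2, even)`),
    tree `Negative/ChernFalseAtTwo.lean` (p154589 ACCEPTED). Crux: `coneExit_false_without_PNe2` with
    the planner's witness `a = u₁u₂ + u₃²u₄ + u₄⁵ + u₃⁷`, `n = 4`, `𝔽₂`, chart `u₃`, `τ = 0`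
    (`step_contact`, `isol_contact` via `X_k^12 ∈ ∂a`, `isol_contact'` via the unit `1 + u₃²u₄⁴`,
    `cone_contact = X₀X₁`, `two_le_dL_contact`): all four hypotheses hold, `dL c = 1` fails. Tree:
    `Negative/ContactStart.lean` (p162040) + `Negative/FalseWithoutPNe2.lean` (p162605), both c2, ACCEPTED
    (the 400-line lint forces the split).
  - `Isol (step i τ c)` — LOAD-BEARING (of course: it is the point). `coneExit_false_without_isolStep`
    PROVED (§7, c2): `p = 3`, `n = 3`, `𝔽₃`, `c = u₁⁴ + u₂⁷ + u₃⁷`, chart `u₂`, `τ = 0`: successor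
    `u₁⁴u₂ + u₂⁴ + u₂⁴u₃⁷` of multiplicity 3, `OrdP c` fails. Tree: `Negative/StepHypotheses.lean`
    (p162290, c2, ACCEPTED).
  - `MultP (step i τ c)` — LOAD-BEARING. `coneExit_false_without_multPStep` PROVED (§7, c2): same
    start, chart `u₁`: successor `u₁ + u₁⁴u₂⁷ + u₁⁴u₃⁷` is a smooth point (`∂₁` is a unit, `jac = ⊤`,
    `Isol` holds trivially), `OrdP c` fails. Tree: same file.
  - `Isol c` — NOT load-bearing: unused by the proof. `ConeExitWithoutIsol` (strengthening, believed
    true); both registered lines already drop it. It is NOT implied by the other hypotheses either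
    (paper, c2): `c = u₁²u₂ + u₂²u₃² + u₃⁷` over `𝔽₃` is singular along the whole `u₂`-axis, yet its
    forced `u₃`-chart successor `u₁²u₂ + u₂²u₃ + u₃⁴` is isolated (`V(u₁u₂, u₁² - u₂u₃, u₂² + u₃³) =
    {0}`) of multiplicity 3 (and `OrdP`, `dL = 1` hold, as the strengthening predicts) — the singular
    axis has tangent `e₂ ∉ L = ⟨e₃⟩`, so its strict transform misses the near point. The stubs' omission
    of `Isol c` is therefore a genuine (harmless) strengthening.
  - `MultP c` — NOT load-bearing EITHER (c2 finding, given `n ≥ 3`): if `clean c = 0` then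
    `step = 0` and `MultP (step)` fails; if `1 ≤ m := ord (clean c) < p` then `s = 0`, `dv i 0 = id`,
    and `step` is the cleaned translated TOTAL transform `T = Σ_{k ≥ m} vᵢ^k a_k(w + v')`
    (`w = update τ i 1`; the `tr` truncation `D j ≤ B i` is again exact); `MultP (step)` forces
    `a_m(w) = 0` (the monomial `vᵢ^m`, `p ∤ m`, survives cleaning and has degree `< p`); for `m ≥ 2`
    every `∂_k T ∈ (vᵢ)`, so `κ[[v]]/jac ↠ κ[[v']]` is infinite; for `m = 1`, `∂ᵢ T ≡ ℓ(w + v') =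
    ℓ'(v')` mod `vᵢ` with `ℓ = a₁` linear, so `κ[[v]]/jac ↠ κ[[v']]/(ℓ')`, infinite when `n - 1 ≥ 2`.
    Hence the TRUE CORE of the crux is `ConeExitStepOnly` (§3): `Isol (step) → MultP (step) →
    OrdP c ∧ dL c = 1` — information for the provers (the stubs may keep `MultP c`; it costs nothing).
  - `PerfectField κ` — NOT load-bearing: `Isol` is invariant under any field extension (`κ[[u]] →
    K[[u]]` is faithfully flat), `MultP/OrdP` are coefficient conditions, `w ∈ Linv` is `κ`-rational so
    `dL_κ ≥ 1`, and `dL_κ ≤ dL_{κ̄}`; the proof runs over `κ̄`.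
  - `CharP κ p` — load-bearing in principle (tame transfer gives only `dL ≤ 2`, STRATEGY-CENSUS
    §Transfer) — outside the summit's scope, not pursued.
* §4 NATURAL STRENGTHENINGS / TIGHTNESS:
  - the CONVERSE of the crux (`OrdP ∧ dL = 1 ⇒` the forced successor is isolated) is FALSE —
    `coneExit_converse_false` PROVED (§4a): `p = 3`, `n = 3`, `𝔽₃`, `conv = u₁²u₂ + u₂⁵ + u₃⁷`
    (isolated, order 3, `dL = 1` EXACTLY) ↦ `u₁²u₂ + u₂⁵u₃² + u₃⁴`, multiplicity 3 but singular along
    the `u₂`-axis; `not_isol_conv'` is a kernel-checked NON-isolatedness proof (axis-vanishing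
    coefficients form an ideal containing `∂a'`; the classes of `u₂^m` are linearly independent). The
    crux is an EXIT lemma, not a persistence lemma. Tree: `Negative/ConverseStart.lean` (p162067) +
    `Negative/ConverseFalse.lean` (p162628), both c2, ACCEPTED.
  - `stub_chern` without `p ≠ 2`: FALSE (above); its `2 ≤ s` is unnecessary (`s ≤ 1`: `∇H = 0`);
    `IsAlgClosed`: load-bearing only for RATIONAL critical points (`p = 5`, `s = 2`, `𝔽₅`,
    `G = uv⁴ + 3u²v³ + 4u⁴v`, `Q = u³ + uv² + v³` irreducible) — irrelevant to the crux.
* §5 NEAR-MISSES: none (no `sorry` in this file).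
* §6 TARGETS — the six stubs of the registered line `critical-plane` (`Lines/critical_plane.lean`;
  lead not yet seated, no stuck stubs handed over). Attacked on paper by c1 AND re-derived
  independently by c2 (degenerate cases, junk models, quantifier audit): ALL SIX TRUE AS TYPED.
  c2 fine print for the provers: `stub_caseA` — `m ≥ p + 2 ⇒ jac ⊆ (vᵢ)`; `m = p + 1 ⇒ jac ⊆
  (vᵢ, a_{p+1}(w + v'))` with `a_{p+1}(w) = 0` forced by `MultP (step)` (coefficient of `vᵢ¹`), and
  `κ[[v']]/(f)`, `f(0) = 0`, `n - 1 ≥ 2` variables, is infinite (Krull: `dim ≥ n - 2 ≥ 1`; this is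
  the one place a dimension fact is needed in Case A). `stub_nearDirection` — the cleaning of `T`
  leaves the coefficients of `v_j'^p` and the constant unconstrained, but those are degree `p` / `0`,
  so `G(w + y) = G(w) + G(y)` on `H = {yᵢ = 0}` still follows, and homogenises via
  `X = Xᵢ w + (X - Xᵢ w)`, `(Xᵢ + S)^p = Xᵢ^p + S^p` — ANY field of characteristic `p`.
  `stub_criticalPlane` — carries `OrdP` but not `MultP`: harmless, only `cone p c ≠ 0` matters;
  `dL ≥ 3`: both directions in `L_K ∩ {xᵢ = 0}` (and `∇a_p = 0` on `span_K L`); `dL = 2`: `s = n - 2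
  ≥ 2` is automatic (`s = 1` would make `a_p` a sum of two p-th powers of linear forms, killed by
  cleaning), Chern on `Ḡ` over `AlgebraicClosure κ`, lift `q`, normalise `ĉ = q - qᵢ w`.
  `stub_planeJacobian` — universally quantified over `ĉ, ℓ` incl. `ĉ = ℓ = 0` (then `ψ` = evaluation
  at `0`; still true: `MultP (step)` kills the linear terms). `stub_planeCriterion` — `n ≤ 2` is
  vacuous (the minor vanishes when `ĉᵢ = ℓᵢ = 0`); `g = 0` is excluded by `λ^N = 0 ⇒ λ = 0`; for
  `g ≠ 0` use Krull's Hauptidealsatz in `K[[y₀, y₁]]` (no UFD needed). No `stub_false` theorem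
  exists; none is expected.
* §7 INDEX of the landed witness certificates, restated by type (the formal `step` is EVALUATED in the
  kernel for every witness; `τ = 0` via `Negative.tr_zero`).
* WHY IT RESISTS (for the provers): `Sing(X') ∩ E = P(Crit a_p ∩ V(a_{p+1}))` EXACTLY (chart formula
  `∂_j ã|_E = (∂_j a_p)(w + ·)`, `∂ᵢ ã|_E = a_{p+1}(w + ·)`), `Crit(a_p) ⊇ L ⊕ κ̄q` with `q` from Chern
  on `κ̄ⁿ/L` (`s = n - dL ≥ 2`), every multiplicity-`p` near point `[w]` has `w ∈ L`, `a_{p+1}(w) = 0`,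
  hence lies on `P(L ⊕ κ̄q) ∩ V(a_{p+1})`, of local dimension `≥ dL - 1 ≥ 1` when `dL ≥ 2` — so
  `¬ Isol (step)`. No `Θ_N` condition is needed (the item's informal `P(N) ∩ {Θ_N = 0} ∩ {a_{p+1} = 0}`
  over-constrains the locus; harmless). Kill criterion (i) of the route cannot fire for odd `p`; the
  censuses 0/2483, 212/212, 0/5238 are predictions of the proof; no further counterexample search is
  warranted. The disprover's remaining contribution is the landed load-bearing table above.
-/

noncomputable section

-- single-problem summit: the doubled namespace component `ResolutionOfSingularities` is forced by the tree layout
set_option linter.dupNamespace false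

namespace Summit.ResolutionOfSingularities.ResolutionOfSingularities.Cruxes.ConeExit.Disproof

open Summit.ResolutionOfSingularities.ResolutionOfSingularities.Theses.WildCones
  (ConeExit ChernCriticalDirection)
-- `Negative.xxx` below = `Summit.….Theorems.ConeExit.Negative.xxx` (the landed tree files)
open Summit.ResolutionOfSingularities.ResolutionOfSingularities.Theorems.ConeExit
-- the mirrored calculus, unqualified (token-identical to `Lines/critical_plane.lean`)
open Summit.ResolutionOfSingularities.ResolutionOfSingularities.Theorems.ConeExit.Negative
  (clean bl ord dv tr step ser pd jac cone Linv dL)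
open scoped BigOperators Classical

/-! ## §1–§2 The crux's calculus (exact mirror) and the `Isol` certificate format — tree
`Negative/Mirror.lean` (p154980): `clean … dL`, `crux_iff`, `tr_zero`, `coeff_ser`, `coeff_pd_ser`,
`module_finite_quotient_of_X_pow_mem`. -/

/-- The mirror is exact (tree theorem, restated by type): `ConeExit` unfolds DEFINITIONALLY onto the
landed operators. -/
example : ConeExit ↔
    ∀ p : ℕ, p.Prime → p ≠ 2 → ∀ n : ℕ, 3 ≤ n → ∀ (κ : Type) [Field κ] [CharP κ p] [PerfectField κ]
      (c : (Fin n → ℕ) → κ) (i : Fin n) (τ : Fin n → κ),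
      Module.Finite κ (MvPowerSeries (Fin n) κ ⧸ jac p c) →
      ((∃ A, clean p c A ≠ 0) ∧ ∀ A, clean p c A ≠ 0 → p ≤ Finset.sum Finset.univ (fun j => A j)) →
      Module.Finite κ (MvPowerSeries (Fin n) κ ⧸ jac p (step p i τ c)) →
      ((∃ A, clean p (step p i τ c) A ≠ 0) ∧
        ∀ A, clean p (step p i τ c) A ≠ 0 → p ≤ Finset.sum Finset.univ (fun j => A j)) →
      (∃ A, clean p c A ≠ 0 ∧ Finset.sum Finset.univ (fun j => A j) = p) ∧ dL p c = 1 :=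
  Negative.crux_iff

/-- The certificate format for `Isol` (tree theorem, restated by type). -/
example {n : ℕ} {κ : Type} [Field κ] (J : Ideal (MvPowerSeries (Fin n) κ)) (N : ℕ)
    (hX : ∀ k : Fin n, MvPowerSeries.X k ^ N ∈ J) : Module.Finite κ (MvPowerSeries (Fin n) κ ⧸ J) :=
  Negative.module_finite_quotient_of_X_pow_mem J N hX

/-! ## §3 Load-bearing hypotheses: the `Without` variants of the crux, by name -/

section Without

/-- `ConeExit` with `3 ≤ n` weakened to `2 ≤ n` (nothing else changed). FALSE:
`coneExit_false_without_N3`. [folklore] -/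
def ConeExitWithoutN3 : Prop :=
  ∀ p : ℕ, p.Prime → p ≠ 2 → ∀ n : ℕ, 2 ≤ n → ∀ (κ : Type) [Field κ] [CharP κ p] [PerfectField κ]
    (c : (Fin n → ℕ) → κ) (i : Fin n) (τ : Fin n → κ),
    Module.Finite κ (MvPowerSeries (Fin n) κ ⧸ jac p c) →
    ((∃ A, clean p c A ≠ 0) ∧ ∀ A, clean p c A ≠ 0 → p ≤ Finset.sum Finset.univ (fun j => A j)) →
    Module.Finite κ (MvPowerSeries (Fin n) κ ⧸ jac p (step p i τ c)) →
    ((∃ A, clean p (step p i τ c) A ≠ 0) ∧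
      ∀ A, clean p (step p i τ c) A ≠ 0 → p ≤ Finset.sum Finset.univ (fun j => A j)) →
    (∃ A, clean p c A ≠ 0 ∧ Finset.sum Finset.univ (fun j => A j) = p) ∧ dL p c = 1

/-- `ConeExit` with `p ≠ 2` deleted (nothing else changed). FALSE: `coneExit_false_without_PNe2`.
[folklore] -/
def ConeExitWithoutPNe2 : Prop :=
  ∀ p : ℕ, p.Prime → ∀ n : ℕ, 3 ≤ n → ∀ (κ : Type) [Field κ] [CharP κ p] [PerfectField κ]
    (c : (Fin n → ℕ) → κ) (i : Fin n) (τ : Fin n → κ),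
    Module.Finite κ (MvPowerSeries (Fin n) κ ⧸ jac p c) →
    ((∃ A, clean p c A ≠ 0) ∧ ∀ A, clean p c A ≠ 0 → p ≤ Finset.sum Finset.univ (fun j => A j)) →
    Module.Finite κ (MvPowerSeries (Fin n) κ ⧸ jac p (step p i τ c)) →
    ((∃ A, clean p (step p i τ c) A ≠ 0) ∧
      ∀ A, clean p (step p i τ c) A ≠ 0 → p ≤ Finset.sum Finset.univ (fun j => A j)) →
    (∃ A, clean p c A ≠ 0 ∧ Finset.sum Finset.univ (fun j => A j) = p) ∧ dL p c = 1

/-- `ConeExit` with the isolatedness of the SUCCESSOR (`Isol (step i τ c)`) deleted (nothing else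
changed). FALSE: `coneExit_false_without_isolStep`. [folklore] -/
def ConeExitWithoutIsolStep : Prop :=
  ∀ p : ℕ, p.Prime → p ≠ 2 → ∀ n : ℕ, 3 ≤ n → ∀ (κ : Type) [Field κ] [CharP κ p] [PerfectField κ]
    (c : (Fin n → ℕ) → κ) (i : Fin n) (τ : Fin n → κ),
    Module.Finite κ (MvPowerSeries (Fin n) κ ⧸ jac p c) →
    ((∃ A, clean p c A ≠ 0) ∧ ∀ A, clean p c A ≠ 0 → p ≤ Finset.sum Finset.univ (fun j => A j)) →
    ((∃ A, clean p (step p i τ c) A ≠ 0) ∧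
      ∀ A, clean p (step p i τ c) A ≠ 0 → p ≤ Finset.sum Finset.univ (fun j => A j)) →
    (∃ A, clean p c A ≠ 0 ∧ Finset.sum Finset.univ (fun j => A j) = p) ∧ dL p c = 1

/-- `ConeExit` with the multiplicity of the SUCCESSOR (`MultP (step i τ c)`) deleted (nothing else
changed). FALSE: `coneExit_false_without_multPStep`. [folklore] -/
def ConeExitWithoutMultPStep : Prop :=
  ∀ p : ℕ, p.Prime → p ≠ 2 → ∀ n : ℕ, 3 ≤ n → ∀ (κ : Type) [Field κ] [CharP κ p] [PerfectField κ]
    (c : (Fin n → ℕ) → κ) (i : Fin n) (τ : Fin n → κ),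
    Module.Finite κ (MvPowerSeries (Fin n) κ ⧸ jac p c) →
    ((∃ A, clean p c A ≠ 0) ∧ ∀ A, clean p c A ≠ 0 → p ≤ Finset.sum Finset.univ (fun j => A j)) →
    Module.Finite κ (MvPowerSeries (Fin n) κ ⧸ jac p (step p i τ c)) →
    (∃ A, clean p c A ≠ 0 ∧ Finset.sum Finset.univ (fun j => A j) = p) ∧ dL p c = 1

/-- `ConeExit` with the isolatedness of the START (`Isol c`) deleted. NOT refutable if the proof
sketch is right (the sketch never uses `Isol c`): a natural STRENGTHENING (both registered lines
already drop `Isol c`). [folklore] -/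
def ConeExitWithoutIsol : Prop :=
  ∀ p : ℕ, p.Prime → p ≠ 2 → ∀ n : ℕ, 3 ≤ n → ∀ (κ : Type) [Field κ] [CharP κ p] [PerfectField κ]
    (c : (Fin n → ℕ) → κ) (i : Fin n) (τ : Fin n → κ),
    ((∃ A, clean p c A ≠ 0) ∧ ∀ A, clean p c A ≠ 0 → p ≤ Finset.sum Finset.univ (fun j => A j)) →
    Module.Finite κ (MvPowerSeries (Fin n) κ ⧸ jac p (step p i τ c)) →
    ((∃ A, clean p (step p i τ c) A ≠ 0) ∧
      ∀ A, clean p (step p i τ c) A ≠ 0 → p ≤ Finset.sum Finset.univ (fun j => A j)) →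
    (∃ A, clean p c A ≠ 0 ∧ Finset.sum Finset.univ (fun j => A j) = p) ∧ dL p c = 1

/-- `ConeExit` with BOTH hypotheses on the START (`Isol c`, `MultP c`) deleted. NOT refutable if the
proof sketch is right: neither is used (cycle-2 finding for `MultP c`, module docstring) — the
sharpest natural STRENGTHENING the provers could aim at (`n ≥ 3` is essential for dropping
`MultP c`). [folklore] -/
def ConeExitStepOnly : Prop :=
  ∀ p : ℕ, p.Prime → p ≠ 2 → ∀ n : ℕ, 3 ≤ n → ∀ (κ : Type) [Field κ] [CharP κ p] [PerfectField κ]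
    (c : (Fin n → ℕ) → κ) (i : Fin n) (τ : Fin n → κ),
    Module.Finite κ (MvPowerSeries (Fin n) κ ⧸ jac p (step p i τ c)) →
    ((∃ A, clean p (step p i τ c) A ≠ 0) ∧
      ∀ A, clean p (step p i τ c) A ≠ 0 → p ≤ Finset.sum Finset.univ (fun j => A j)) →
    (∃ A, clean p c A ≠ 0 ∧ Finset.sum Finset.univ (fun j => A j) = p) ∧ dL p c = 1

/-- The strengthenings imply the crux (trivially) and each other in the obvious order. [folklore] -/
theorem coneExit_of_withoutIsol : ConeExitWithoutIsol → ConeExit := by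
  intro h p hp hp2 n hn κ _ _ _ c i τ
  show _ → _ → _ → _ → _
  intro _ hM hI' hM'
  exact h p hp hp2 n hn κ c i τ hM hI' hM'

/-- See `coneExit_of_withoutIsol`. [folklore] -/
theorem withoutIsol_of_stepOnly : ConeExitStepOnly → ConeExitWithoutIsol :=
  fun h p hp hp2 n hn κ _ _ _ c i τ _ hI' hM' => h p hp hp2 n hn κ c i τ hI' hM'

/-- **`3 ≤ n` is load-bearing** — tree theorem `Negative.coneExit_false_without_N3`
(`FalseWithoutN3.lean`, p161940): `p = 3`, `n = 2`, `𝔽₃`, `u₁⁴ + u₂⁷ ↦ u₁⁴u₂ + u₂⁴` (chart `u₂`,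
`τ = 0`), both isolated of multiplicity 3, `OrdP` fails. [folklore] -/
theorem coneExit_false_without_N3 : ¬ ConeExitWithoutN3 :=
  Negative.coneExit_false_without_N3

/-- **`p ≠ 2` is load-bearing** — tree theorem `Negative.coneExit_false_without_PNe2`
(`ContactStart.lean` p162040 + `FalseWithoutPNe2.lean` p162605): `p = 2`, `n = 4`, `𝔽₂`, the contact
form `u₁u₂ + u₃²u₄ + u₄⁵ + u₃⁷ ↦ u₁u₂ + u₃u₄ + u₃⁵ + u₃³u₄⁵` (chart `u₃`, `τ = 0`), both isolated of
multiplicity 2, order 2, `dL = 2 ≠ 1`; mechanism-level companion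
`Negative.chernCriticalDirection_false_without_pne2` (`ChernFalseAtTwo.lean`, p154589). [folklore] -/
theorem coneExit_false_without_PNe2 : ¬ ConeExitWithoutPNe2 :=
  Negative.coneExit_false_without_PNe2

/-- **`Isol (step i τ c)` is load-bearing** — tree theorem `Negative.coneExit_false_without_isolStep`
(`StepHypotheses.lean`, p162290): `p = 3`, `n = 3`, `𝔽₃`, `u₁⁴ + u₂⁷ + u₃⁷ ↦ u₁⁴u₂ + u₂⁴ + u₂⁴u₃⁷`
(chart `u₂`, `τ = 0`), multiplicity 3, `OrdP c` fails. [folklore] -/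
theorem coneExit_false_without_isolStep : ¬ ConeExitWithoutIsolStep :=
  Negative.coneExit_false_without_isolStep

/-- **`MultP (step i τ c)` is load-bearing** — tree theorem `Negative.coneExit_false_without_multPStep`
(`StepHypotheses.lean`, p162290): same start, chart `u₁`: `u₁ + u₁⁴u₂⁷ + u₁⁴u₃⁷` is a smooth point
(`(∂a') = (1)`), `OrdP c` fails. [folklore] -/
theorem coneExit_false_without_multPStep : ¬ ConeExitWithoutMultPStep :=
  Negative.coneExit_false_without_multPStep

end Without

/-! ## §4a The CONVERSE of the crux is false — tree theorem `Negative.coneExit_converse_false`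
(`ConverseStart.lean` p162067 + `ConverseFalse.lean` p162628): `OrdP ∧ dL = 1` (start isolated of
multiplicity `p`, successor of multiplicity `p`) does NOT make the forced successor isolated. -/

/-- The converse of `ConeExit` is false (tree theorem, restated by type): witness `p = 3`, `n = 3`, `𝔽₃`,
`u₁²u₂ + u₂⁵ + u₃⁷ ↦ u₁²u₂ + u₂⁵u₃² + u₃⁴` (chart `u₃`, `τ = 0`), singular along the `u₂`-axis
(`Negative.not_isol_conv'` is a kernel-checked NON-isolatedness proof). [folklore] -/
theorem coneExit_converse_false :
    ¬ ∀ p : ℕ, p.Prime → p ≠ 2 → ∀ n : ℕ, 3 ≤ n → ∀ (κ : Type) [Field κ] [CharP κ p] [PerfectField κ]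
        (c : (Fin n → ℕ) → κ) (i : Fin n) (τ : Fin n → κ),
        Module.Finite κ (MvPowerSeries (Fin n) κ ⧸ jac p c) →
        ((∃ A, clean p c A ≠ 0) ∧ ∀ A, clean p c A ≠ 0 → p ≤ Finset.sum Finset.univ (fun j => A j)) →
        ((∃ A, clean p c A ≠ 0 ∧ Finset.sum Finset.univ (fun j => A j) = p) ∧ dL p c = 1) →
        ((∃ A, clean p (step p i τ c) A ≠ 0) ∧
          ∀ A, clean p (step p i τ c) A ≠ 0 → p ≤ Finset.sum Finset.univ (fun j => A j)) →
        Module.Finite κ (MvPowerSeries (Fin n) κ ⧸ jac p (step p i τ c)) :=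
  Negative.coneExit_converse_false

/-! ## §4b Tightness of the one deep stub (`stub_chern` = `ChernCriticalDirection`) — tree
`Negative/ChernFalseAtTwo.lean` (p154589). -/

section Chern

open MvPolynomial

/-- `p ≠ 2` is load-bearing in the critical-direction lemma (tree theorem, restated by type). -/
example : ¬ ∀ p : ℕ, p.Prime → ∀ (s : ℕ), 2 ≤ s → ∀ (k : Type) [Field k] [CharP k p] [IsAlgClosed k]
    (H : MvPolynomial (Fin s) k), H.IsHomogeneous p → H ≠ 0 →
    ∃ v : Fin s → k, v ≠ 0 ∧ ∀ j : Fin s, eval v (pderiv j H) = 0 :=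
  Negative.chernCriticalDirection_false_without_pne2

/-- The contact form has no critical direction over any field (tree theorem, restated by type). -/
example (k : Type) [Field k] : ∃ H : MvPolynomial (Fin 2) k, H.IsHomogeneous 2 ∧ H ≠ 0 ∧
    ∀ v : Fin 2 → k, (∀ j : Fin 2, eval v (pderiv j H) = 0) → v = 0 :=
  Negative.contactForm_no_critical_direction k

end Chern

/-! ## §7 Index of the landed witness certificates (by type; the formal `step` is EVALUATED in the
kernel in each case, `τ = 0` via `Negative.tr_zero`) -/

section WitnessIndex

open MvPowerSeries

/-- `n = 2` witness: the formal step. -/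
example : step 3 (1 : Fin 2) (0 : Fin 2 → ZMod 3) Negative.fermat = Negative.fermat' :=
  Negative.step_fermat

/-- `n = 2` witness: both states isolated (certificates `X_k^6`, `X_k^7 ∈ ∂a`). -/
example : Module.Finite (ZMod 3) (MvPowerSeries (Fin 2) (ZMod 3) ⧸ jac 3 Negative.fermat) ∧
    Module.Finite (ZMod 3) (MvPowerSeries (Fin 2) (ZMod 3) ⧸ jac 3 Negative.fermat') :=
  ⟨Negative.isol_fermat, Negative.isol_fermat'⟩

/-- `p = 2` witness: the formal step, the cone, `dL ≥ 2`, both states isolated. -/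
example : step 2 (2 : Fin 4) (0 : Fin 4 → ZMod 2) Negative.contact = Negative.contact' ∧
    cone 2 Negative.contact = (MvPolynomial.X 0 * MvPolynomial.X 1 : MvPolynomial (Fin 4) (ZMod 2)) ∧
    2 ≤ dL 2 Negative.contact ∧
    Module.Finite (ZMod 2) (MvPowerSeries (Fin 4) (ZMod 2) ⧸ jac 2 Negative.contact) ∧
    Module.Finite (ZMod 2) (MvPowerSeries (Fin 4) (ZMod 2) ⧸ jac 2 Negative.contact') :=
  ⟨Negative.step_contact, Negative.cone_contact, Negative.two_le_dL_contact, Negative.isol_contact,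
    Negative.isol_contact'⟩

/-- Converse witness: the formal step, `dL = 1` exactly, start isolated, successor NOT isolated. -/
example : step 3 (2 : Fin 3) (0 : Fin 3 → ZMod 3) Negative.conv = Negative.conv' ∧
    dL 3 Negative.conv = 1 ∧
    Module.Finite (ZMod 3) (MvPowerSeries (Fin 3) (ZMod 3) ⧸ jac 3 Negative.conv) ∧
    ¬ Module.Finite (ZMod 3) (MvPowerSeries (Fin 3) (ZMod 3) ⧸ jac 3 Negative.conv') :=
  ⟨Negative.step_conv, Negative.dL_conv, Negative.isol_conv, Negative.not_isol_conv'⟩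

/-- Successor-hypothesis witnesses: one start, two charts. -/
example : step 3 (1 : Fin 3) (0 : Fin 3 → ZMod 3) Negative.fermat3 = Negative.fermat3b ∧
    step 3 (0 : Fin 3) (0 : Fin 3 → ZMod 3) Negative.fermat3 = Negative.fermat3a ∧
    Module.Finite (ZMod 3) (MvPowerSeries (Fin 3) (ZMod 3) ⧸ jac 3 Negative.fermat3) ∧
    Module.Finite (ZMod 3) (MvPowerSeries (Fin 3) (ZMod 3) ⧸ jac 3 Negative.fermat3a) :=
  ⟨Negative.step_fermat3_chart1, Negative.step_fermat3_chart0, Negative.isol_fermat3,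
    Negative.isol_fermat3a⟩

end WitnessIndex

/-! ## §6 Targets (stubs of line `critical-plane`): no kill, none expected; see the module docstring. -/

end Summit.ResolutionOfSingularities.ResolutionOfSingularities.Cruxes.ConeExit.Disproof

end
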